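import Summits.BirchSwinnertonDyer.BirchSwinnertonDyer.Theorems.KimAtThreeShallowEqDeepWildDifferent
import Summits.BirchSwinnertonDyer.BirchSwinnertonDyer.Theorems.KimAtThreeSemiLocalTraceDualLocal
import Summits.BirchSwinnertonDyer.BirchSwinnertonDyer.Theorems.KimAtThreeShallowEqDeepRiderOfWeightedCompat
import HarnessLib

/-!
# Route `KimAtThreeKolyvagin` (W2): the tame-ramification trace lemma at a wild level `m = 3m′`, PER COMPLETION —
# `Tr_{L_w/ℚ_v}(a·𝒪_w) ⊆ 𝒪_v ⇒ m′(1 − ζ^{m′})·a ∈ 𝒪_w` at every place `w ∣ p` of `L = ℚ(ζ_m)`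
# (the local input (W) of the wild weight of the shallow package (C1ₑₓʷ); items 19599 · 19077; seat w2-c4 gen 11)

Cell `bsd-addord`, seat `bsd-addord-w2-c4` (gen 11).  `--supports` 19077 (helper).  TOOL theorems only (no
definition, no named fact, no instance, no `sorry`); nothing about any curve; nothing booked; BSD is not proved by
any of this.  Credit: the transport is seat w2-acc3 gen 5's (`KimAtThreeSemiLocalTraceDual` §4,
`KimAtThreeSemiLocalTraceDualLocal`) on seat w2-acc4's `Ψ : ℚ_p ⊗ ℚ(ζ_m) ≃ ∏_{w ∣ p} ℚ(ζ_m)_w`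
(`exists_padicTensorAlgEquiv`, `padicTensor_trace`, `padicTensor_mem_adicCompletionIntegers_of_mem_span`); the
sharp multiplier `m′(1 − ζ^{m′})` (instead of `m`) is the sibling `KimAtThreeShallowEqDeepWildDifferent`.

WHY.  memo HOME/w2c4/W2C4-WEIGHTED-COMPAT-g11.md §3 (W): the weighted compatibility of the shallow off-stratum rows
needs, at the RAMIFIED places `w ∣ 3` of a wild level `ℚ(ζ_{3m′})`, the inverse-different bound with the uniformiser
`1 − ζ₃` only (w2-acc3's `pow_padicValNat_mul_mem_adicCompletionIntegers_of_forall_trace_mul_mem` gives `3·a`).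
* §1 `wild_mul_mem_cycIntLattice_of_norm_trace_mul_zeta_pow_le_one` — the rider's currency: `‖Tr(a·(1 ⊗ ζ^j))‖ ≤ 1`
  for all `j` ⇒ `(1 ⊗ m′(1 − ζ^{m′}))·a ∈ cycIntLattice p m`; `wild_mul_symm_mem_cycIntLattice_of_forall_trace_mul_mem`
  — per-`Ψ` form: every `y_w` in the trace dual of `𝒪_w` ⇒ `(1 ⊗ m′(1 − ζ^{m′}))·Ψ⁻¹y ∈ cycIntLattice p m` (the
  sharp twin of w2-acc3's `pow_padicValNat_smul_symm_mem_cycIntLattice_of_forall_trace_mul_mem`, which costs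
  `p^{v_p(m)}`; this is the form w2-c2 g9's `…KatoParts` consumes).
* §2 ★ **`wild_mul_mem_adicCompletionIntegers_of_forall_trace_mul_mem`** (any prime `p`, `m = 3m′`, any `w₀ ∣ p`):
  `Tr_{L_{w₀}/ℚ_v}(a·o) ∈ 𝒪_v` for all `o ∈ 𝒪_{w₀}` ⇒ `ι_{w₀}(m′(1 − ζ_m^{m′}))·a ∈ 𝒪_{w₀}`
  (`ι_{w₀} : ℚ(ζ_m) → L_{w₀}`).  At `p = 3` (`3 ∤ m′`, so `m′ ∈ 𝒪_{w₀}ˣ`): `(1 − ζ₃)·𝒪_{w₀}^∨ ⊆ 𝒪_{w₀}`.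
* §3 `weight_natCast_mul_one_sub_zeta_pow` — at `p = 3`, `3 ∣ m`, `3 ∤ m′ := m/3`: `θ = m′(1 − ζ_m^{m′})` is an
  admissible WEIGHT of `KimAtThreeShallowEqDeepRiderOfWeightedCompat` (`(1 ⊗ θ)²·(m′⁻² ⊗ (−ζ₃²)) = 3 ⊗ 1`), so §2's
  multiplier can be used as the wild weight verbatim (no unit-stripping).
With the sibling `KimAtThreeShallowEqDeepSharpLattice` (tame places, `3·exp*_w ⊆ 𝒪_w`) this completes the
field-side input of «(C1ₑₓʷ) ⟸ hKatoV2ᵘ ∧ R-κ ∧ (S5a) ∧ (S5b-tower)»; what remains is the weighted twin of w2-c2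
g9's `KimAtThreeDeepLowerKatoParts.definedKatoUniformThree_of_katoParts` (memo §3 (K)).

References: [CasselsFrohlichANT1967] Ch. II §10 (10.2), §11; [SerreLocalFields1979] Ch. III §6; [Kim2022StructureSelmer]
§3.4.1 (the semi-local `exp*` lattice); memo W2C4-WEIGHTED-COMPAT-g11 §3.
-/

set_option autoImplicit false
-- the Theorems namespace of a single-conjunct summit repeats the summit name by design (D-0017)
set_option linter.dupNamespace false
-- `CyclotomicField m ℚ`'s two `ℚ`-algebra structures agree only up to unfolding (as in w2-acc3's sibling files)
set_option backward.isDefEq.respectTransparency false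

noncomputable section

open scoped TensorProduct NumberField
open NumberField Polynomial IsDedekindDomain
open Literature.NumberTheory.AdelicBaseChange
open Summit.BirchSwinnertonDyer.Rank1Residual.GaloisImage
open Summit.BirchSwinnertonDyer.BirchSwinnertonDyer.Theorems.KimAtThreePortSharedSATCore
open Summit.BirchSwinnertonDyer.BirchSwinnertonDyer.Theorems.KimAtThreeSemiLocalTraceDual
open Summit.BirchSwinnertonDyer.BirchSwinnertonDyer.Theorems.KimAtThreeSemiLocalTraceDualCyc
open Summit.BirchSwinnertonDyer.BirchSwinnertonDyer.Theorems.KimAtThreeSemiLocalTraceDualLevel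
open Summit.BirchSwinnertonDyer.BirchSwinnertonDyer.Theorems.KimAtThreeSemiLocalTraceDualLocal
open Summit.BirchSwinnertonDyer.BirchSwinnertonDyer.Theorems.KimAtThreeShallowEqDeepWildDifferent

namespace Summit.BirchSwinnertonDyer.BirchSwinnertonDyer.Theorems.KimAtThreeShallowEqDeepWildDifferentLocal

variable {m m' : ℕ} [NeZero m] (p : ℕ) [Fact p.Prime]

/-! ### §1 Semi-local forms in the rider's currency `cycIntLattice p m = ℤ_p⟨1 ⊗ ζ_m^j⟩` -/

/-- **`(1 ⊗ m′(1 − ζ^{m′}))·(cycIntLattice p m)^∨ ⊆ cycIntLattice p m`** (any prime `p`, `m = 3m′`): if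
`a ∈ ℚ_p ⊗ ℚ(ζ_m)` has `‖Tr(a·(1 ⊗ ζ_m^j))‖ ≤ 1` for every `j`, then `(1 ⊗ m′(1 − ζ_m^{m′}))·a ∈ cycIntLattice p m`
— the sharp twin of w2-acc3's `natCast_smul_mem_cycIntLattice_of_norm_trace_mul_zeta_pow_le_one` (`m·a`), same
proof (dual-basis expansion; `m′(1 − ζ^{m′})·d_i ∈ ℤ[ζ]` read in `ℤ_p⟨1 ⊗ ζ^j⟩` by
`one_tmul_mem_cycIntLattice_of_mem_adjoin`). [cite: Kim2022StructureSelmer, §3.4.1 (the lattice `ℤ_p ⊗ ℤ[ζ_n]` in the proof of Thm. 3.13)] -/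
theorem wild_mul_mem_cycIntLattice_of_norm_trace_mul_zeta_pow_le_one (hm : m = 3 * m')
    {a : ℚ_[p] ⊗[ℚ] CyclotomicField m ℚ}
    (ha : ∀ j : ℕ, ‖Algebra.trace ℚ_[p] (ℚ_[p] ⊗[ℚ] CyclotomicField m ℚ)
        (a * ((1 : ℚ_[p]) ⊗ₜ[ℚ] (IsCyclotomicExtension.zeta m ℚ (CyclotomicField m ℚ) ^ j)))‖ ≤ 1) :
    ((1 : ℚ_[p]) ⊗ₜ[ℚ] ((m' : CyclotomicField m ℚ) *
        (1 - IsCyclotomicExtension.zeta m ℚ (CyclotomicField m ℚ) ^ m'))) * a ∈ cycIntLattice p m := by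
  classical
  have hζ := IsCyclotomicExtension.zeta_spec m ℚ (CyclotomicField m ℚ)
  set ζ := IsCyclotomicExtension.zeta m ℚ (CyclotomicField m ℚ) with hζdef
  set c : CyclotomicField m ℚ := (m' : CyclotomicField m ℚ) * (1 - ζ ^ m') with hc
  set pb : PowerBasis ℚ (CyclotomicField m ℚ) := IsPrimitiveRoot.powerBasis ℚ hζ with hpb
  have hgen : pb.gen = ζ := IsPrimitiveRoot.powerBasis_gen ℚ hζ
  set d : Module.Basis (Fin pb.dim) ℚ (CyclotomicField m ℚ) := pb.basis.traceDual with hd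
  set f : Module.Basis (Fin pb.dim) ℚ_[p] (ℚ_[p] ⊗[ℚ] CyclotomicField m ℚ) :=
    Algebra.TensorProduct.basis ℚ_[p] d with hf
  have htr : ∀ i j : Fin pb.dim,
      Algebra.trace ℚ_[p] (ℚ_[p] ⊗[ℚ] CyclotomicField m ℚ) (f j * ((1 : ℚ_[p]) ⊗ₜ[ℚ] (ζ ^ (i : ℕ)))) =
        if i = j then 1 else 0 := by
    intro i j
    rw [hf, Algebra.TensorProduct.basis_apply, Algebra.TensorProduct.tmul_mul_tmul, one_mul,
      trace_one_tmul, hd]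
    have hb : ζ ^ (i : ℕ) = pb.basis i := by rw [pb.coe_basis, hgen]
    rw [hb, Module.Basis.trace_traceDual_mul]
    split_ifs <;> simp
  have hcoord : ∀ i : Fin pb.dim, f.repr a i =
      Algebra.trace ℚ_[p] (ℚ_[p] ⊗[ℚ] CyclotomicField m ℚ) (a * ((1 : ℚ_[p]) ⊗ₜ[ℚ] (ζ ^ (i : ℕ)))) := by
    intro i
    conv_rhs => rw [← f.sum_repr a]
    rw [Finset.sum_mul, map_sum]
    simp_rw [smul_mul_assoc, map_smul, htr, smul_eq_mul, mul_ite, mul_one, mul_zero]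
    rw [Finset.sum_ite_eq]
    simp
  -- `(1 ⊗ c)·(1 ⊗ d_i) = 1 ⊗ (c·d_i)` with `c·d_i ∈ ℤ[ζ]`
  have hmf : ∀ i : Fin pb.dim, ((1 : ℚ_[p]) ⊗ₜ[ℚ] c) * f i ∈ cycIntLattice p m := by
    intro i
    obtain ⟨z, hz, hzeq⟩ := exists_wild_mul_traceDual_eq hm hζ i
    have h1z := one_tmul_mem_cycIntLattice_of_mem_adjoin m p hz
    have hdi : d i = (IsPrimitiveRoot.powerBasis ℚ hζ).basis.traceDual i := rfl
    have heq : ((1 : ℚ_[p]) ⊗ₜ[ℚ] c) * f i = (1 : ℚ_[p]) ⊗ₜ[ℚ] z := by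
      rw [hf, Algebra.TensorProduct.basis_apply, Algebra.TensorProduct.tmul_mul_tmul, one_mul, ← hzeq, ← hdi, hc]
    rw [heq]
    exact h1z
  rw [← f.sum_repr a, Finset.mul_sum]
  refine Submodule.sum_mem _ fun i _ => ?_
  rw [mul_smul_comm]
  obtain ⟨r, hr⟩ := exists_padicInt_coe_eq_of_norm_le_one (p := p) (x := f.repr a i) (by
    rw [hcoord]; exact ha i)
  rw [← hr, ← padicInt_smul_eq_coe_smul]
  exact Submodule.smul_mem _ r (hmf i)

/-- **Per-`Ψ` form, any prime `p`, `m = 3m′`**: for seat w2-acc4's `Ψ : ℚ_p ⊗ ℚ(ζ_m) ≃ ∏_{w ∣ p} ℚ(ζ_m)_w`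
(pure-tensor formula `hΨ`), a family `y = (y_w)_w` with every `y_w` in the trace dual of `𝒪_w` has
`(1 ⊗ m′(1 − ζ_m^{m′}))·Ψ⁻¹ y ∈ cycIntLattice p m` (w2-acc3's `norm_trace_symm_mul_one_tmul_zeta_pow_le_one` + §1)
— the sharp twin of their `pow_padicValNat_smul_symm_mem_cycIntLattice_of_forall_trace_mul_mem` (`p^{v_p(m)}·Ψ⁻¹y`).
[cite: CasselsFrohlichANT1967, Ch. II §10 Theorem (10.2) and §11] -/
theorem wild_mul_symm_mem_cycIntLattice_of_forall_trace_mul_mem (hm : m = 3 * m')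
    [Fintype (((Rat.HeightOneSpectrum.primesEquiv (R := 𝓞 ℚ)).symm ⟨p, Fact.out⟩).Extension
      (𝓞 (CyclotomicField m ℚ)))]
    (Ψ : ℚ_[p] ⊗[ℚ] CyclotomicField m ℚ ≃ₐ[ℚ]
      (Π w : ((Rat.HeightOneSpectrum.primesEquiv (R := 𝓞 ℚ)).symm ⟨p, Fact.out⟩).Extension
        (𝓞 (CyclotomicField m ℚ)), w.1.adicCompletion (CyclotomicField m ℚ)))
    (hΨ : ∀ (s : ℚ_[p]) (x : CyclotomicField m ℚ)
      (w : ((Rat.HeightOneSpectrum.primesEquiv (R := 𝓞 ℚ)).symm ⟨p, Fact.out⟩).Extension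
        (𝓞 (CyclotomicField m ℚ))),
      Ψ (s ⊗ₜ[ℚ] x) w = algebraMap (CyclotomicField m ℚ) (w.1.adicCompletion (CyclotomicField m ℚ)) x *
        algebraMap (((Rat.HeightOneSpectrum.primesEquiv (R := 𝓞 ℚ)).symm ⟨p, Fact.out⟩).adicCompletion ℚ)
          (w.1.adicCompletion (CyclotomicField m ℚ)) (Padic.adicCompletionEquiv (𝓞 ℚ) ⟨p, Fact.out⟩ s))
    (y : Π w : ((Rat.HeightOneSpectrum.primesEquiv (R := 𝓞 ℚ)).symm ⟨p, Fact.out⟩).Extension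
        (𝓞 (CyclotomicField m ℚ)), w.1.adicCompletion (CyclotomicField m ℚ))
    (hy : ∀ w, ∀ o ∈ w.1.adicCompletionIntegers (CyclotomicField m ℚ),
      Algebra.trace (((Rat.HeightOneSpectrum.primesEquiv (R := 𝓞 ℚ)).symm ⟨p, Fact.out⟩).adicCompletion ℚ)
          (w.1.adicCompletion (CyclotomicField m ℚ)) (y w * o) ∈
        (((Rat.HeightOneSpectrum.primesEquiv (R := 𝓞 ℚ)).symm ⟨p, Fact.out⟩).adicCompletionIntegers ℚ)) :
    ((1 : ℚ_[p]) ⊗ₜ[ℚ] ((m' : CyclotomicField m ℚ) *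
        (1 - IsCyclotomicExtension.zeta m ℚ (CyclotomicField m ℚ) ^ m'))) * Ψ.symm y ∈ cycIntLattice p m :=
  wild_mul_mem_cycIntLattice_of_norm_trace_mul_zeta_pow_le_one p hm
    (norm_trace_symm_mul_one_tmul_zeta_pow_le_one m p Ψ hΨ y hy)

/-! ### §2 Per-completion form: `m′(1 − ζ^{m′})·𝒪_{w₀}^∨ ⊆ 𝒪_{w₀}` -/

/-- ★ **The tame-ramification trace lemma at a wild level** (any prime `p`, `m = 3m′`, any place `w₀ ∣ p` of
`ℚ(ζ_m)`): if `a ∈ ℚ(ζ_m)_{w₀}` has `Tr_{ℚ(ζ_m)_{w₀}/ℚ_v}(a·o) ∈ 𝒪_v` for every `o ∈ 𝒪_{w₀}`, then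
`ι_{w₀}(m′(1 − ζ_m^{m′}))·a ∈ 𝒪_{w₀}`.  Proof: the family `(a at w₀, 0 elsewhere)`, §1, and w2-acc4's INTO
inclusion `Ψ(L_int′) ⊆ ∏ 𝒪_w`; `Ψ` is multiplicative and `Ψ(1 ⊗ c)_{w₀} = ι_{w₀}(c)`.  At `p = 3` (`3 ∤ m′`): the
inverse different of the tamely ramified `ℚ(ζ_m)_{w₀}/ℚ₃` costs only the uniformiser `1 − ζ₃`, `ζ₃ = ζ_m^{m′}`.
[cite: SerreLocalFields1979, Ch. III §6, Prop. 13] [cite: CasselsFrohlichANT1967, Ch. II §10 Theorem (10.2) and §11] -/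
theorem wild_mul_mem_adicCompletionIntegers_of_forall_trace_mul_mem (hm : m = 3 * m')
    [Fintype (((Rat.HeightOneSpectrum.primesEquiv (R := 𝓞 ℚ)).symm ⟨p, Fact.out⟩).Extension
      (𝓞 (CyclotomicField m ℚ)))]
    (w₀ : ((Rat.HeightOneSpectrum.primesEquiv (R := 𝓞 ℚ)).symm ⟨p, Fact.out⟩).Extension
      (𝓞 (CyclotomicField m ℚ)))
    (a : w₀.1.adicCompletion (CyclotomicField m ℚ))
    (ha : ∀ o ∈ w₀.1.adicCompletionIntegers (CyclotomicField m ℚ),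
      Algebra.trace (((Rat.HeightOneSpectrum.primesEquiv (R := 𝓞 ℚ)).symm ⟨p, Fact.out⟩).adicCompletion ℚ)
          (w₀.1.adicCompletion (CyclotomicField m ℚ)) (a * o) ∈
        (((Rat.HeightOneSpectrum.primesEquiv (R := 𝓞 ℚ)).symm ⟨p, Fact.out⟩).adicCompletionIntegers ℚ)) :
    algebraMap (CyclotomicField m ℚ) (w₀.1.adicCompletion (CyclotomicField m ℚ))
        ((m' : CyclotomicField m ℚ) * (1 - IsCyclotomicExtension.zeta m ℚ (CyclotomicField m ℚ) ^ m')) * a ∈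
      w₀.1.adicCompletionIntegers (CyclotomicField m ℚ) := by
  classical
  obtain ⟨Ψ, hΨ⟩ := exists_padicTensorAlgEquiv (CyclotomicField m ℚ) p
  have hmem := KimAtThreeFineKatoSemiLocalLattice.cycIntLattice_le_span_ringOfIntegers p m
    (wild_mul_symm_mem_cycIntLattice_of_forall_trace_mul_mem p hm Ψ hΨ _
      (forall_trace_single_mul_mem m p w₀ a ha))
  have h := padicTensor_mem_adicCompletionIntegers_of_mem_span
    (Ψ : ℚ_[p] ⊗[ℚ] CyclotomicField m ℚ →ₐ[ℚ] _) hΨ hmem w₀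
  change Ψ (_ * Ψ.symm _) w₀ ∈ _ at h
  rwa [map_mul, Pi.mul_apply, Ψ.apply_symm_apply, Pi.single_eq_same, hΨ, map_one, map_one, mul_one] at h

/-! ### §3 The multiplier `m′(1 − ζ_m^{m′})` is an admissible weight at `p = 3` -/

/-- **`θ = m′(1 − ζ_m^{m′})` is a weight at `p = 3` on a wild level `m`, `3 ∣ m`, `3 ∤ m′ := m/3`**:
`1 ⊗ θ ∈ L_int(m)` and `(1 ⊗ θ)·(1 ⊗ θ)·l₀ = 3 ⊗ 1` with `l₀ := m′⁻² ⊗ (−ζ₃²) ∈ L_int(m)` (`m′⁻¹ ∈ ℤ₃`,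
`(1 − ζ₃)²·(−ζ₃²) = 3`; `KimAtThreeShallowEqDeepRiderOfWeightedCompat.weight_one_sub_zeta_pow` scaled by a unit) —
so the multiplier of §2 is usable VERBATIM as the wild weight of the weighted compatibility. [folklore] -/
theorem weight_natCast_mul_one_sub_zeta_pow (n : ℕ) [NeZero n] (hn : 3 ∣ n) (hn' : ¬ 3 ∣ n / 3) :
    ((1 : ℚ_[3]) ⊗ₜ[ℚ] (((n / 3 : ℕ) : CyclotomicField n ℚ) *
        (1 - IsCyclotomicExtension.zeta n ℚ (CyclotomicField n ℚ) ^ (n / 3)))) ∈ cycIntLattice 3 n ∧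
    ∃ l₀ ∈ cycIntLattice 3 n,
      ((1 : ℚ_[3]) ⊗ₜ[ℚ] (((n / 3 : ℕ) : CyclotomicField n ℚ) *
          (1 - IsCyclotomicExtension.zeta n ℚ (CyclotomicField n ℚ) ^ (n / 3)))) *
        ((1 : ℚ_[3]) ⊗ₜ[ℚ] (((n / 3 : ℕ) : CyclotomicField n ℚ) *
          (1 - IsCyclotomicExtension.zeta n ℚ (CyclotomicField n ℚ) ^ (n / 3)))) * l₀ =
        (((3 : ℕ) : ℚ_[3]) ⊗ₜ[ℚ] (1 : CyclotomicField n ℚ)) := by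
  obtain ⟨hθ, l₀, hl₀, hθθ⟩ := KimAtThreeShallowEqDeepRiderOfWeightedCompat.weight_one_sub_zeta_pow n hn
  -- `m′` is a `3`-adic unit
  have hnorm : ‖((n / 3 : ℕ) : ℤ_[3])‖ = 1 := by
    refine le_antisymm (PadicInt.norm_le_one _) (not_lt.mp fun hlt => hn' ?_)
    have := (PadicInt.norm_int_lt_one_iff_dvd (p := 3) ((n / 3 : ℕ) : ℤ)).mp (by exact_mod_cast hlt)
    exact_mod_cast this
  obtain ⟨u, hu⟩ := PadicInt.isUnit_iff.mpr hnorm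
  -- `1 ⊗ (m′·θ₀) = (m′ ⊗ 1)·(1 ⊗ θ₀)`
  have hsplit : ((1 : ℚ_[3]) ⊗ₜ[ℚ] (((n / 3 : ℕ) : CyclotomicField n ℚ) *
        (1 - IsCyclotomicExtension.zeta n ℚ (CyclotomicField n ℚ) ^ (n / 3)))) =
      ((((n / 3 : ℕ) : ℤ_[3]) : ℚ_[3]) ⊗ₜ[ℚ] (1 : CyclotomicField n ℚ)) *
        ((1 : ℚ_[3]) ⊗ₜ[ℚ] (1 - IsCyclotomicExtension.zeta n ℚ (CyclotomicField n ℚ) ^ (n / 3))) := by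
    have h3K : ((n / 3 : ℕ) : CyclotomicField n ℚ) *
        (1 - IsCyclotomicExtension.zeta n ℚ (CyclotomicField n ℚ) ^ (n / 3)) =
        ((n / 3 : ℕ) : ℚ) • (1 - IsCyclotomicExtension.zeta n ℚ (CyclotomicField n ℚ) ^ (n / 3)) := by
      rw [Algebra.smul_def, map_natCast]
    rw [h3K, TensorProduct.tmul_smul, TensorProduct.smul_tmul', Algebra.TensorProduct.tmul_mul_tmul, mul_one,
      one_mul, PadicInt.coe_natCast]
    congr 1
    rw [Algebra.smul_def, mul_one, map_natCast]
  refine ⟨?_, ((((u⁻¹ * u⁻¹ : ℤ_[3]ˣ) : ℤ_[3]) : ℚ_[3]) ⊗ₜ[ℚ] (1 : CyclotomicField n ℚ)) * l₀, ?_, ?_⟩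
  · rw [hsplit]
    exact mul_mem_cycIntLattice 3 n (GroupRingEval.coe_tmul_one_mem_cycIntLattice 3 n _) hθ
  · exact mul_mem_cycIntLattice 3 n (GroupRingEval.coe_tmul_one_mem_cycIntLattice 3 n _) hl₀
  · rw [hsplit]
    have hU : ((((n / 3 : ℕ) : ℤ_[3]) : ℚ_[3]) ⊗ₜ[ℚ] (1 : CyclotomicField n ℚ)) *
        ((((n / 3 : ℕ) : ℤ_[3]) : ℚ_[3]) ⊗ₜ[ℚ] (1 : CyclotomicField n ℚ)) *
        ((((u⁻¹ * u⁻¹ : ℤ_[3]ˣ) : ℤ_[3]) : ℚ_[3]) ⊗ₜ[ℚ] (1 : CyclotomicField n ℚ)) = 1 := by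
      rw [Algebra.TensorProduct.tmul_mul_tmul, Algebra.TensorProduct.tmul_mul_tmul, mul_one, mul_one,
        ← PadicInt.coe_mul, ← PadicInt.coe_mul, ← hu, Units.val_mul]
      rw [show ((u : ℤ_[3]) * (u : ℤ_[3]) * ((u⁻¹ : ℤ_[3]ˣ) * (u⁻¹ : ℤ_[3]ˣ) : ℤ_[3]) : ℤ_[3]) = 1 by
        rw [mul_mul_mul_comm, Units.mul_inv, one_mul], PadicInt.coe_one]
      rfl
    calc _ = (((((n / 3 : ℕ) : ℤ_[3]) : ℚ_[3]) ⊗ₜ[ℚ] (1 : CyclotomicField n ℚ)) *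
          ((((n / 3 : ℕ) : ℤ_[3]) : ℚ_[3]) ⊗ₜ[ℚ] (1 : CyclotomicField n ℚ)) *
          ((((u⁻¹ * u⁻¹ : ℤ_[3]ˣ) : ℤ_[3]) : ℚ_[3]) ⊗ₜ[ℚ] (1 : CyclotomicField n ℚ))) *
          (((1 : ℚ_[3]) ⊗ₜ[ℚ] (1 - IsCyclotomicExtension.zeta n ℚ (CyclotomicField n ℚ) ^ (n / 3))) *
            ((1 : ℚ_[3]) ⊗ₜ[ℚ] (1 - IsCyclotomicExtension.zeta n ℚ (CyclotomicField n ℚ) ^ (n / 3))) * l₀) := by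
          ring
      _ = _ := by rw [hU, one_mul, hθθ]

end Summit.BirchSwinnertonDyer.BirchSwinnertonDyer.Theorems.KimAtThreeShallowEqDeepWildDifferentLocal

end
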